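import Literature.NumberTheory.LFunctions.FordZetaBoundMain12
import Literature.NumberTheory.LFunctions.VinogradovKorobovInputs
import HarnessLib

/-!
# Ford's Theorem 1 with the constant `74.7`: `|ζ(σ + it)| ≤ 74.7 t^{4.45(1−σ)^{3/2}} log^{2/3} t` from Theorem 2

Topic `Literature/NumberTheory/LFunctions`. Everything in this file is PROVED; no definition and
no named fact is introduced.

`FordZetaBoundMain.lean` / `FordZetaBoundMain12.lean` deduce Ford's Theorem 1 AS PRINTED
(`zeta_bound_ford`: `A = 76.2`, `B = 4.45`; K. Ford, Proc. London Math. Soc. (3) 85 (2002),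
Theorem 1) from his Theorem 2 (the explicit Vinogradov–Korobov bound
`S(N, t) ≤ 9.463 N^{1−1/(133.66λ²)}`, kept as a HYPOTHESIS), resp. from the weaker bound with
`9.463` replaced by `12`, and record that the deduction certifies a smaller constant
(`(2 + e^{(34/25)³} + 2·12)/300^{2/3} + 10·5.113·1.443 < 74.7`). This file states that stronger
conclusion, which the tree now needs: with MTY's Lemma 4.7 corrected
(`zero_inequality_mossinghoff_trudgian_yang_corrected`), the large-height region of
Mossinghoff–Trudgian–Yang follows from a Richert bound with `B = 4.45` only when `A ≤ 74.9`
(`zero_bound_large_height_of_richertBound`, `VinogradovKorobovLargeHeightWith.lean`), not from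
`A = 76.2`.

* `FordVK.crude_segment_with`, `FordVK.crude_numerics747`, `FordVK.zeta_bound747_of_le_fifteen_sixteenths`,
  `FordVK.zeta_bound747_of_le_exp_300` — the crude range (Lemma 7.1 of the source, in the in-tree
  form of `FordZetaBoundCrude.lean`) with `74.7` (the five certified segments of
  `FordVK.crude_numerics` have ≥ 5 % to spare);
* `FordVK.zeta_bound747_main_of_tail12` — the main range `t ≥ e^{300}`, `σ ≥ 15/16`
  (`FordVK.zeta_bound_ford_main_of_tail12` with the last numerical step sharpened from `≤ 76.2` to
  `≤ 74.7`: `2/44.8 + 36.38/44.8 + 73.8 = 74.66`);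
* `zeta_bound747_of_exp_sum_bound12`, `zeta_bound747_of_exp_sum_bound`,
  `zeta_bound747_of_exp_sum_bound12_large_lambda` — **Theorem 1 with `74.7` from Theorem 2**
  (constant `12`; as printed, `9.463`; constant `12` for `λ ≥ 8` only, the range `λ ≤ 8` being the
  theorem `FordVK.expSum_bound_small_lambda`), and `richertBound747_of_exp_sum_bound12*` — the
  two-sided form `RichertBound 74.7 4.45`.

Proofs are those of the `76.2` files verbatim with the final constant changed; all lemmas of
`FordZetaBoundCrude/Tail/Kappa12/Main12.lean` are reused, only the three statements carrying the
constant are re-derived.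

## References

* K. Ford, *Vinogradov's integral and bounds for the Riemann zeta function*, Proc. London Math.
  Soc. (3) 85 (2002), 565–633; arXiv:1910.08209 — Theorems 1–2, Lemmas 7.1–7.3, §7. [Ford2002]
-/

noncomputable section

open Complex Real Finset MeasureTheory intervalIntegral

namespace Literature.NumberTheory.LFunctions

namespace FordVK

/-! ## The crude range with `74.7` -/

/-- One segment of the one-variable inequality of the crude range, constant `A₀` as a parameter:
on `L₀ ≤ L ≤ L₁`, `1 + 1.0182 e^{c₀L}(L + 13/6) ≤ A₀ L^{2/3}` from `e^{c₀L₁} ≤ E`, `r³ ≤ L₀²`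
and `1 + 1.0182 E (L₁ + 13/6) ≤ A₀ r` (`FordVK.crude_segment` is `A₀ = 76.2`). [folklore] -/
theorem crude_segment_with {A₀ L L₀ L₁ E r f : ℝ} {k : ℕ} (hA₀ : 0 ≤ A₀) (hL₀ : 0 < L₀)
    (h0 : L₀ ≤ L) (h1 : L ≤ L₁)
    (hkf : (k : ℝ) + f = 1600 / 213867 * L₁) (hf0 : 0 ≤ f) (hf1 : f ≤ 1)
    (hE : VK.expUB k f ≤ E) (hr3 : r ^ 3 ≤ L₀ ^ 2)
    (hnum : 1 + 1.0182 * E * (L₁ + 13 / 6) ≤ A₀ * r) :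
    1 + 1.0182 * Real.exp (1600 / 213867 * L) * (L + 13 / 6) ≤ A₀ * L ^ (2 / 3 : ℝ) := by
  have hL : 0 < L := hL₀.trans_le h0
  have hexp : Real.exp (1600 / 213867 * L) ≤ E := by
    have h := VK.exp_le_of_expUB_le hf0 hf1 hE
    rw [hkf] at h
    exact (Real.exp_le_exp.2 (by nlinarith)).trans h
  have hr' : r ≤ L ^ (2 / 3 : ℝ) := by
    refine le_of_pow_le_pow_left₀ (n := 3) (by norm_num) (by positivity) ?_
    rw [VK.rpow_two_thirds_pow_three hL.le]
    exact hr3.trans (pow_le_pow_left₀ hL₀.le h0 2)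
  have hE0 : 0 ≤ E := (Real.exp_pos _).le.trans hexp
  have h2 : Real.exp (1600 / 213867 * L) * (L + 13 / 6) ≤ E * (L₁ + 13 / 6) :=
    mul_le_mul hexp (by linarith) (by linarith) hE0
  have h3 : A₀ * r ≤ A₀ * L ^ (2 / 3 : ℝ) := mul_le_mul_of_nonneg_left hr' hA₀
  nlinarith

/-- The one-variable inequality of the crude range with `74.7`: for `1.09 ≤ L ≤ 300`,
`1 + 1.0182 e^{1600 L/213867}(L + 13/6) ≤ 74.7 L^{2/3}` (the five segments of
`FordVK.crude_numerics`; the binding one, `[262, 300]`, has `2903.7 ≤ 3058.2`). [folklore] -/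
theorem crude_numerics747 {L : ℝ} (h0 : 1.09 ≤ L) (h1 : L ≤ 300) :
    1 + 1.0182 * Real.exp (1600 / 213867 * L) * (L + 13 / 6) ≤ 74.7 * L ^ (2 / 3 : ℝ) := by
  have hA : (0 : ℝ) ≤ 74.7 := by norm_num
  rcases le_or_gt L 10 with hA' | hA'
  · exact crude_segment_with (L₀ := 1.09) (L₁ := 10) (k := 0) (f := 16000 / 213867) (E := 1.078)
      (r := 1.059) hA (by norm_num) h0 hA' (by norm_num) (by norm_num) (by norm_num)
      (by norm_num [VK.expUB]) (by norm_num) (by norm_num)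
  rcases le_or_gt L 60 with hB | hB
  · exact crude_segment_with (L₀ := 10) (L₁ := 60) (k := 0) (f := 96000 / 213867) (E := 1.567)
      (r := 4.64) hA (by norm_num) hA'.le hB (by norm_num) (by norm_num) (by norm_num)
      (by norm_num [VK.expUB]) (by norm_num) (by norm_num)
  rcases le_or_gt L 200 with hC | hC
  · exact crude_segment_with (L₀ := 60) (L₁ := 200) (k := 1) (f := 320000 / 213867 - 1) (E := 4.465)
      (r := 15.32) hA (by norm_num) hB.le hC (by norm_num) (by norm_num) (by norm_num)
      (by norm_num [VK.expUB]) (by norm_num) (by norm_num)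
  rcases le_or_gt L 262 with hD | hD
  · exact crude_segment_with (L₀ := 200) (L₁ := 262) (k := 1) (f := 419200 / 213867 - 1) (E := 7.101)
      (r := 34.19) hA (by norm_num) hC.le hD (by norm_num) (by norm_num) (by norm_num)
      (by norm_num [VK.expUB]) (by norm_num) (by norm_num)
  · exact crude_segment_with (L₀ := 262) (L₁ := 300) (k := 2) (f := 480000 / 213867 - 2) (E := 9.435)
      (r := 40.94) hA (by norm_num) hD.le h1 (by norm_num) (by norm_num) (by norm_num)
      (by norm_num [VK.expUB]) (by norm_num) (by norm_num)

/-- **The range `1/2 ≤ σ ≤ 15/16` (all `t ≥ 3`) with `74.7`**: `|ζ(σ+it)| ≤ 21.6 t^{1−σ}` and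
`t^{1−σ} ≤ t^{4.45(1−σ)^{3/2}}` (`FordVK.zeta_bound_ford_of_le_fifteen_sixteenths` verbatim).
[cite: Ford2002, Lemma 7.1 (case σ ≤ 15/16)] -/
theorem zeta_bound747_of_le_fifteen_sixteenths {σ t : ℝ} (ht : 3 ≤ t) (hσ : 1 / 2 ≤ σ)
    (hσ1 : σ ≤ 15 / 16) :
    ‖riemannZeta (σ + t * I)‖
      ≤ 74.7 * t ^ (4.45 * (1 - σ) ^ (3 / 2 : ℝ)) * Real.log t ^ (2 / 3 : ℝ) := by
  have ht0 : 0 < t := by linarith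
  have ht1 : 1 ≤ t := by linarith
  have h0 := norm_zeta_le_sum_add ht hσ (by linarith)
  set N : ℕ := ⌊t⌋₊ + 1 with hN
  have hN1 : 1 ≤ N := by simp [hN]
  have h1 := sum_rpow_neg_le_div (by linarith : 0 ≤ σ) (by linarith) hN1
  have h2 := rpow_floor_succ_le ht (by linarith : σ ≤ 1)
  rw [← hN] at h2
  have h3 : (4 / 3 : ℝ) ^ (1 - σ) ≤ 1.1548 := by
    have : (4 / 3 : ℝ) ^ (1 - σ) ≤ (4 / 3 : ℝ) ^ (1 / 2 : ℝ) :=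
      Real.rpow_le_rpow_of_exponent_le (by norm_num) (by linarith)
    refine this.trans ?_
    rw [← Real.sqrt_eq_rpow, Real.sqrt_le_left (by norm_num)]
    norm_num
  have hX0 : 0 ≤ t ^ (1 - σ) := by positivity
  have hNle : (N : ℝ) ^ (1 - σ) ≤ 1.1548 * t ^ (1 - σ) := h2.trans (by nlinarith)
  have h4 : (N : ℝ) ^ (1 - σ) / (1 - σ) ≤ 16 * (N : ℝ) ^ (1 - σ) := by
    rw [div_le_iff₀ (by linarith)]
    have : 0 ≤ (N : ℝ) ^ (1 - σ) := by positivity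
    nlinarith
  have h5 : 1 ≤ t ^ (1 - σ) := Real.one_le_rpow ht1 (by linarith)
  have hζ : ‖riemannZeta (σ + t * I)‖ ≤ 21.6 * t ^ (1 - σ) := by
    have : ‖riemannZeta (σ + t * I)‖ ≤ 1 + (16 + 11 / 6) * (N : ℝ) ^ (1 - σ) := by linarith
    nlinarith
  have h6 : t ^ (1 - σ) ≤ t ^ (4.45 * (1 - σ) ^ (3 / 2 : ℝ)) := by
    apply Real.rpow_le_rpow_of_exponent_le ht1
    have hv : (1 : ℝ) / 16 ≤ 1 - σ := by linarith
    have hv0 : 0 < 1 - σ := by linarith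
    have e : (1 - σ) ^ (3 / 2 : ℝ) = (1 - σ) * (1 - σ) ^ (1 / 2 : ℝ) := by
      rw [show (3 / 2 : ℝ) = 1 + 1 / 2 by norm_num, Real.rpow_add hv0, Real.rpow_one]
    have hsq : (1 : ℝ) / 4 ≤ (1 - σ) ^ (1 / 2 : ℝ) := by
      rw [← Real.sqrt_eq_rpow, Real.le_sqrt (by norm_num) hv0.le]
      linarith
    rw [e]
    nlinarith
  have h7 : 1 ≤ Real.log t ^ (2 / 3 : ℝ) := by
    apply Real.one_le_rpow _ (by norm_num)
    exact le_trans (by norm_num) (VK.log_three_ge.trans (Real.log_le_log (by norm_num) ht))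
  have h8 : 0 ≤ t ^ (4.45 * (1 - σ) ^ (3 / 2 : ℝ)) := by positivity
  calc ‖riemannZeta (σ + t * I)‖ ≤ 21.6 * t ^ (1 - σ) := hζ
    _ ≤ 74.7 * t ^ (4.45 * (1 - σ) ^ (3 / 2 : ℝ)) * 1 := by linarith
    _ ≤ 74.7 * t ^ (4.45 * (1 - σ) ^ (3 / 2 : ℝ)) * Real.log t ^ (2 / 3 : ℝ) :=
        mul_le_mul_of_nonneg_left h7 (by positivity)

/-- **The range `15/16 ≤ σ ≤ 1`, `3 ≤ t ≤ e^{300}` with `74.7`**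
(`FordVK.zeta_bound_ford_of_le_exp_300` verbatim with `crude_numerics747`).
[cite: Ford2002, Lemma 7.1 (case t ≤ 10^100)] -/
theorem zeta_bound747_of_le_exp_300 {σ t : ℝ} (ht : 3 ≤ t) (ht' : t ≤ Real.exp 300)
    (hσ : 15 / 16 ≤ σ) (hσ1 : σ ≤ 1) :
    ‖riemannZeta (σ + t * I)‖
      ≤ 74.7 * t ^ (4.45 * (1 - σ) ^ (3 / 2 : ℝ)) * Real.log t ^ (2 / 3 : ℝ) := by
  have ht0 : 0 < t := by linarith
  have ht1 : 1 ≤ t := by linarith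
  have h0 := norm_zeta_le_sum_add ht (by linarith) hσ1
  set N : ℕ := ⌊t⌋₊ + 1 with hN
  have hN1 : 1 ≤ N := by simp [hN]
  have hN0 : (0 : ℝ) < N := by exact_mod_cast hN1
  have hNt' : (N : ℝ) ≤ t + 1 := by rw [hN]; push_cast; linarith [Nat.floor_le ht0.le]
  have h1 := sum_rpow_neg_le_log (by linarith : 0 ≤ σ) hσ1 hN1
  set L : ℝ := Real.log t with hL
  have hL3 : 1.09 ≤ L := VK.log_three_ge.trans (Real.log_le_log (by norm_num) ht)
  have hL300 : L ≤ 300 := by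
    rw [hL, Real.log_le_iff_le_exp ht0]; exact ht'
  -- `log N ≤ L + 1/3`
  have hlogN : Real.log N ≤ L + 1 / 3 := by
    have e : t + 1 = t * (1 + 1 / t) := by field_simp
    have h2 : Real.log N ≤ Real.log (t + 1) := Real.log_le_log hN0 hNt'
    have h3 : Real.log (t + 1) = L + Real.log (1 + 1 / t) := by
      rw [e, Real.log_mul ht0.ne' (by positivity), hL]
    have h4 : Real.log (1 + 1 / t) ≤ 1 / t := by
      have := Real.log_le_sub_one_of_pos (by positivity : (0 : ℝ) < 1 + 1 / t); linarith
    have h5 : 1 / t ≤ 1 / 3 := one_div_le_one_div_of_le (by norm_num) ht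
    linarith
  -- `N^{1-σ} ≤ 1.0182 t^{1-σ}`
  have hNpow : (N : ℝ) ^ (1 - σ) ≤ 1.0182 * t ^ (1 - σ) := by
    have h2 := rpow_floor_succ_le ht hσ1
    rw [← hN] at h2
    have h3 : (4 / 3 : ℝ) ^ (1 - σ) ≤ 1.0182 :=
      (Real.rpow_le_rpow_of_exponent_le (by norm_num) (by linarith)).trans
        four_thirds_rpow_sixteenth_le
    have h4 : 0 ≤ t ^ (1 - σ) := by positivity
    nlinarith
  -- hence `|ζ| ≤ 1 + 1.0182 t^{1-σ} (L + 13/6)`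
  have hlogN0 : 0 ≤ Real.log N := Real.log_nonneg (by exact_mod_cast hN1)
  have hζ : ‖riemannZeta (σ + t * I)‖ ≤ 1 + 1.0182 * t ^ (1 - σ) * (L + 13 / 6) := by
    have h2 : ‖riemannZeta (σ + t * I)‖ ≤ 1 + (N : ℝ) ^ (1 - σ) * (Real.log N + 11 / 6) := by
      linarith
    have h3 : (N : ℝ) ^ (1 - σ) * (Real.log N + 11 / 6) ≤ (1.0182 * t ^ (1 - σ)) * (L + 13 / 6) :=
      mul_le_mul hNpow (by linarith) (by linarith) (by positivity)
    linarith
  -- exponent comparison: `t^{1-σ} ≤ e^{c₀ L} t^{B''}`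
  set B'' : ℝ := 4.45 * (1 - σ) ^ (3 / 2 : ℝ) with hB''
  have hB0 : 0 ≤ B'' := by rw [hB'']; positivity
  have htpow : t ^ (1 - σ) ≤ Real.exp (1600 / 213867 * L) * t ^ B'' := by
    have e : 1 - σ = ((1 - σ) - B'') + B'' := by ring
    rw [e, Real.rpow_add ht0]
    refine mul_le_mul_of_nonneg_right ?_ (by positivity)
    have h2 : (1 - σ) - B'' ≤ 1600 / 213867 := by rw [hB'']; exact sub_rpow_three_halves_le hσ1
    calc t ^ ((1 - σ) - B'') ≤ t ^ (1600 / 213867 : ℝ) := Real.rpow_le_rpow_of_exponent_le ht1 h2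
      _ = Real.exp (1600 / 213867 * L) := by
          rw [Real.rpow_def_of_pos ht0, hL]; ring_nf
  have htB : 1 ≤ t ^ B'' := Real.one_le_rpow ht1 hB0
  have hG := crude_numerics747 hL3 hL300
  have hE0 : 0 ≤ Real.exp (1600 / 213867 * L) := (Real.exp_pos _).le
  have hL0 : 0 ≤ L + 13 / 6 := by linarith
  -- assemble
  calc ‖riemannZeta (σ + t * I)‖ ≤ 1 + 1.0182 * t ^ (1 - σ) * (L + 13 / 6) := hζ
    _ ≤ 1 + 1.0182 * (Real.exp (1600 / 213867 * L) * t ^ B'') * (L + 13 / 6) := by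
        gcongr
    _ ≤ t ^ B'' * (1 + 1.0182 * Real.exp (1600 / 213867 * L) * (L + 13 / 6)) := by
        nlinarith [mul_nonneg hE0 hL0]
    _ ≤ t ^ B'' * (74.7 * L ^ (2 / 3 : ℝ)) := mul_le_mul_of_nonneg_left hG (by positivity)
    _ = 74.7 * t ^ B'' * L ^ (2 / 3 : ℝ) := by ring

/-- **The crude range with `74.7`**: for `1/2 ≤ σ ≤ 1`, `t ≥ 3`, and `σ ≤ 15/16` or `t ≤ e^{300}`,
`|ζ(σ + it)| ≤ 74.7 t^{4.45(1−σ)^{3/2}} (log t)^{2/3}`. [cite: Ford2002, Lemma 7.1] -/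
theorem zeta_bound747_crude {σ t : ℝ} (ht : 3 ≤ t) (hσ : 1 / 2 ≤ σ) (hσ1 : σ ≤ 1)
    (h : σ ≤ 15 / 16 ∨ t ≤ Real.exp 300) :
    ‖riemannZeta (σ + t * I)‖
      ≤ 74.7 * t ^ (4.45 * (1 - σ) ^ (3 / 2 : ℝ)) * Real.log t ^ (2 / 3 : ℝ) := by
  rcases le_or_gt σ (15 / 16) with h1 | h1
  · exact zeta_bound747_of_le_fifteen_sixteenths ht hσ h1
  · rcases h with h | h
    · exact absurd h (not_le.2 h1)
    · exact zeta_bound747_of_le_exp_300 ht h h1.le hσ1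

/-! ## The main range with `74.7` -/

/-- **The main range of Ford's Theorem 1 from Theorem 2 (constant `12`) with `74.7`** (Lemma 7.3
of the source, in the in-tree form; `FordVK.zeta_bound_ford_main_of_tail12` verbatim except for
the last numerical step `2/44.8 + 36.38/44.8 + 73.8 ≤ 74.7`). For `15/16 ≤ σ ≤ 1`, `t ≥ e^{300}`,
given the tail bound `‖ζ(s) − ∑_{n ≤ ⌊t⌋} n^{−s}‖ ≤ 1` and the exponential-sum bound at `u = 0`
for this `t` (hypothesis `hS`): `|ζ(σ + it)| ≤ 74.7 t^{4.45(1−σ)^{3/2}} (log t)^{2/3}`.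
[cite: Ford2002, Lemma 7.3] -/
theorem zeta_bound747_main_of_tail12 {σ t : ℝ} (hσ : 15 / 16 ≤ σ) (hσ1 : σ ≤ 1)
    (ht : Real.exp 300 ≤ t)
    (htail : ‖riemannZeta (σ + t * I)
      - ∑ n ∈ Finset.Icc 1 ⌊t⌋₊, (n : ℂ) ^ (-((σ : ℂ) + t * I))‖ ≤ 1)
    (hS : ∀ N R : ℕ, 1 ≤ N → (N : ℝ) ≤ t → N < R → R ≤ 2 * N →
      ‖∑ n ∈ Finset.Ioc N R, (n : ℂ) ^ (-(t * I))‖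
        ≤ 12 * (N : ℝ) ^ (1 - Real.log N ^ 2 / (133.66 * Real.log t ^ 2))) :
    ‖riemannZeta (σ + t * I)‖
      ≤ 74.7 * t ^ (4.45 * (1 - σ) ^ (3 / 2 : ℝ)) * Real.log t ^ (2 / 3 : ℝ) := by
  have h300 : (300 : ℝ) + 1 ≤ Real.exp 300 := Real.add_one_le_exp 300
  have ht0 : 0 < t := by linarith
  have ht1 : 1 ≤ t := by linarith
  have hσ0 : 0 ≤ σ := by linarith
  have h1σ : 0 ≤ 1 - σ := by linarith
  set L : ℝ := Real.log t with hL
  have hL300 : 300 ≤ L := by rw [hL, Real.le_log_iff_exp_le ht0]; exact ht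
  have hL0 : 0 < L := by linarith
  obtain ⟨hΛQ, hQ⟩ := main_constants hL300
  set N₁ : ℕ := ⌊t⌋₊ with hN₁
  have hN₁1 : 1 ≤ N₁ := Nat.le_floor (by exact_mod_cast ht1)
  set s : ℂ := (σ : ℂ) + t * I with hs
  -- Step 1–2: `‖ζ‖ ≤ 2 + ‖∑_{1 < n ≤ N₁} n^{-s}‖`
  have hsplit : ∑ n ∈ Finset.Icc 1 N₁, (n : ℂ) ^ (-s) = 1 + ∑ n ∈ Finset.Ioc 1 N₁, (n : ℂ) ^ (-s) := by
    rw [show Finset.Icc 1 N₁ = Finset.Ioc 0 N₁ from Finset.Icc_add_one_left_eq_Ioc 0 N₁,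
      ← Finset.sum_Ioc_consecutive _ (Nat.zero_le 1) hN₁1]
    congr 1
    simp
  have h12 : ‖riemannZeta s‖ ≤ 2 + ‖∑ n ∈ Finset.Ioc 1 N₁, (n : ℂ) ^ (-s)‖ := by
    set Z : ℂ := riemannZeta s with hZ
    set S : ℂ := ∑ n ∈ Finset.Icc 1 N₁, (n : ℂ) ^ (-s) with hSdef
    set T : ℂ := ∑ n ∈ Finset.Ioc 1 N₁, (n : ℂ) ^ (-s) with hT
    have e : Z = (Z - S) + (1 + T) := by rw [hsplit]; ring
    calc ‖Z‖ = ‖(Z - S) + (1 + T)‖ := congrArg (‖·‖) e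
      _ ≤ ‖Z - S‖ + ‖1 + T‖ := norm_add_le _ _
      _ ≤ 1 + (‖(1 : ℂ)‖ + ‖T‖) := add_le_add htail (norm_add_le _ _)
      _ = 2 + ‖T‖ := by simp; ring
  -- Step 3: dyadic decomposition
  have hdy := norm_sum_Ioc_one_le_dyadic12 hσ0 ht1 hS
  rw [← hN₁, ← hL] at hdy
  -- Step 4: the scale `W` and the parameter `y`
  set Λ : ℝ := (133.66 * L ^ 2) ^ (1 / 3 : ℝ) with hΛ
  have hΛ0 : 0 < Λ := by rw [hΛ]; positivity
  have hΛ3 : Λ ^ 3 = 133.66 * L ^ 2 := by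
    rw [hΛ, ← Real.rpow_natCast, ← Real.rpow_mul (by positivity)]; norm_num
  have hlog2 : 0.6931471803 < Real.log 2 := Real.log_two_gt_d9
  have hlog2' : 0 < Real.log 2 := by linarith
  set W : ℝ := Λ / Real.log 2 with hW
  have hW0 : 0 < W := by rw [hW]; positivity
  have hW3 : Real.log 2 ^ 3 / (133.66 * L ^ 2) = 1 / W ^ 3 := by
    rw [hW, div_pow, hΛ3]; field_simp
  set a : ℝ := (1 - σ) * Real.log 2 with ha
  have ha0 : 0 ≤ a := by rw [ha]; positivity
  have haW : a * W = (1 - σ) * Λ := by rw [ha, hW]; field_simp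
  set y : ℝ := Real.sqrt (a * W / 3) with hy
  have hy0 : 0 ≤ y := Real.sqrt_nonneg _
  have hy2 : y ^ 2 = a * W / 3 := by rw [hy, Real.sq_sqrt (by positivity)]
  have hay : a * W = 3 * y ^ 2 := by rw [hy2]; ring
  -- rewrite the dyadic sum in the form of `dyadic_sum_le12`
  have hdy' : ‖∑ n ∈ Finset.Ioc 1 N₁, (n : ℂ) ^ (-s)‖
      ≤ ∑ i ∈ Finset.range (Nat.log 2 N₁ + 1),
          min (Real.exp (a * i)) (12 * Real.exp (a * i - (i : ℝ) ^ 3 / W ^ 3)) := by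
    refine hdy.trans (le_of_eq (Finset.sum_congr rfl fun i _ ↦ ?_))
    rw [hW3, ha]; ring_nf
  have hmain := hdy'.trans (dyadic_sum_le12 ha0 hW0 hy0 hay _)
  -- Step 6: `e^{2y³} ≤ t^{B''}`
  set B'' : ℝ := 4.45 * (1 - σ) ^ (3 / 2 : ℝ) with hB''
  have hB0 : 0 ≤ B'' := by rw [hB'']; positivity
  set P : ℝ := t ^ B'' with hP
  have hP1 : 1 ≤ P := Real.one_le_rpow ht1 hB0
  have hEP : Real.exp (2 * y ^ 3) ≤ P := by
    rw [hP, Real.rpow_def_of_pos ht0, ← hL]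
    apply Real.exp_le_exp.2
    have h32 : ((1 - σ) ^ (3 / 2 : ℝ)) ^ 2 = (1 - σ) ^ 3 := by
      rw [← Real.rpow_natCast, ← Real.rpow_mul h1σ]; norm_num
    have hX : 0 ≤ (1 - σ) ^ 3 * L ^ 2 := by positivity
    have e2 : (2 * y ^ 3) ^ 2 = 4 * 133.66 / 27 * ((1 - σ) ^ 3 * L ^ 2) := by
      have e1 : (2 * y ^ 3) ^ 2 = 4 * (y ^ 2) ^ 3 := by ring
      rw [e1, hy2, haW, div_pow, mul_pow, hΛ3]; ring
    have e3 : (L * B'') ^ 2 = 4.45 ^ 2 * ((1 - σ) ^ 3 * L ^ 2) := by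
      rw [hB'', mul_pow, mul_pow, h32]; ring
    have hsq : (2 * y ^ 3) ^ 2 ≤ (L * B'') ^ 2 := by
      rw [e2, e3]; exact mul_le_mul_of_nonneg_right (by norm_num) hX
    have h2 : 0 ≤ L * B'' := by positivity
    exact (pow_le_pow_iff_left₀ (by positivity) h2 two_ne_zero).1 hsq
  -- Step 7: `W ≤ 7.38 L^{2/3}`
  set Q : ℝ := L ^ (2 / 3 : ℝ) with hQdef
  have hQ0 : 0 ≤ Q := by rw [hQdef]; positivity
  have hWQ : W ≤ 7.38 * Q := by
    have h1 : W ≤ 1.443 * Λ := by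
      rw [hW, div_le_iff₀ hlog2']
      nlinarith [mul_nonneg hΛ0.le (by linarith : (0 : ℝ) ≤ 1.443 * Real.log 2 - 1)]
    calc W ≤ 1.443 * Λ := h1
      _ ≤ 1.443 * (5.113 * Q) := by gcongr
      _ ≤ 7.38 * Q := by nlinarith [hQ0]
  -- Step 8: assemble (`2/44.8 + 36.38/44.8 + 73.8 ≤ 74.7`)
  have hE0 : 0 < Real.exp (2 * y ^ 3) := Real.exp_pos _
  have hfin : ‖riemannZeta s‖ ≤ 2 + (12.38 + 2 * 12 + 10 * W) * Real.exp (2 * y ^ 3) := by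
    linarith
  have hWE : W * Real.exp (2 * y ^ 3) ≤ (7.38 * Q) * P := mul_le_mul hWQ hEP hE0.le (by positivity)
  have hQP : 44.8 * P ≤ Q * P := mul_le_mul_of_nonneg_right hQ (by linarith)
  have hEP' : (12.38 + 2 * 12) * Real.exp (2 * y ^ 3) ≤ (12.38 + 2 * 12) * P :=
    mul_le_mul_of_nonneg_left hEP (by norm_num)
  have hQP0 : 0 ≤ Q * P := by positivity
  calc ‖riemannZeta s‖ ≤ 2 + (12.38 + 2 * 12 + 10 * W) * Real.exp (2 * y ^ 3) := hfin
    _ = 2 + (12.38 + 2 * 12) * Real.exp (2 * y ^ 3) + 10 * (W * Real.exp (2 * y ^ 3)) := by ring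
    _ ≤ 2 * P + (12.38 + 2 * 12) * P + 10 * ((7.38 * Q) * P) := by linarith
    _ ≤ 74.7 * P * Q := by linarith
    _ = 74.7 * t ^ B'' * L ^ (2 / 3 : ℝ) := by rw [hP, hQdef]

end FordVK

/-! ## Theorem 1 with `74.7` from the exponential-sum hypotheses -/

open FordVK in
/-- **Ford's Theorem 1 with the constant `74.7`, from the exponential-sum bound with constant
`12`.** If, for all integers `1 ≤ N < R ≤ 2N` and reals `t ≥ N`, `0 < u ≤ 1`,
`‖∑_{N < n ≤ R} (n + u)^{−it}‖ ≤ 12 N^{1 − (log N)²/(133.66 (log t)²)}`, then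
`|ζ(σ + it)| ≤ 74.7 t^{4.45 (1−σ)^{3/2}} (log t)^{2/3}` for all `t ≥ 3`, `1/2 ≤ σ ≤ 1`
(crude range `zeta_bound747_crude`, main range `zeta_bound747_main_of_tail12` with
`FordVK.norm_zeta_sub_sum_le_one` and the hypothesis at `u = 0`,
`FordVK.norm_sum_Ioc_cpow_le_of_shifted`). [cite: Ford2002, Theorem 1 (proof, §7)] -/
theorem zeta_bound747_of_exp_sum_bound12
    (hT2 : ∀ (N R : ℕ) (t u : ℝ), 1 ≤ N → (N : ℝ) ≤ t → 0 < u → u ≤ 1 → N < R → R ≤ 2 * N →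
      ‖∑ n ∈ Finset.Ioc N R, ((n : ℂ) + u) ^ (-(t * I))‖
        ≤ 12 * (N : ℝ) ^ (1 - Real.log N ^ 2 / (133.66 * Real.log t ^ 2))) :
    ∀ σ t : ℝ, 3 ≤ t → 1 / 2 ≤ σ → σ ≤ 1 →
      ‖riemannZeta (σ + t * I)‖ ≤ 74.7 * t ^ (4.45 * (1 - σ) ^ (3 / 2 : ℝ)) * Real.log t ^ (2 / 3 : ℝ) := by
  intro σ t ht hσ hσ1
  rcases le_or_gt t (Real.exp 300) with h300 | h300
  · exact zeta_bound747_crude ht hσ hσ1 (Or.inr h300)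
  rcases le_or_gt σ (15 / 16) with h15 | h15
  · exact zeta_bound747_crude ht hσ hσ1 (Or.inl h15)
  have hS : ∀ N R : ℕ, 1 ≤ N → (N : ℝ) ≤ t → N < R → R ≤ 2 * N →
      ‖∑ n ∈ Finset.Ioc N R, (n : ℂ) ^ (-(t * I))‖
        ≤ 12 * (N : ℝ) ^ (1 - Real.log N ^ 2 / (133.66 * Real.log t ^ 2)) :=
    fun N R hN hNt hNR hR ↦
      norm_sum_Ioc_cpow_le_of_shifted fun u hu0 hu1 ↦ hT2 N R t u hN hNt hu0 hu1 hNR hR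
  exact zeta_bound747_main_of_tail12 h15.le hσ1 h300.le
    (norm_zeta_sub_sum_le_one h15.le hσ1 h300.le) hS

/-- **Ford's Theorem 1 with `74.7` from Ford's Theorem 2 as printed** (`S(N, t) ≤ 9.463 N^{1−1/(133.66λ²)}`
for `0 < u ≤ 1`, `1 ≤ N ≤ t`; `9.463 ≤ 12`). [cite: Ford2002, Theorems 1–2] -/
theorem zeta_bound747_of_exp_sum_bound
    (hT2 : ∀ (N R : ℕ) (t u : ℝ), 1 ≤ N → (N : ℝ) ≤ t → 0 < u → u ≤ 1 → N < R → R ≤ 2 * N →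
      ‖∑ n ∈ Finset.Ioc N R, ((n : ℂ) + u) ^ (-(t * I))‖
        ≤ 9.463 * (N : ℝ) ^ (1 - Real.log N ^ 2 / (133.66 * Real.log t ^ 2))) :
    ∀ σ t : ℝ, 3 ≤ t → 1 / 2 ≤ σ → σ ≤ 1 →
      ‖riemannZeta (σ + t * I)‖ ≤ 74.7 * t ^ (4.45 * (1 - σ) ^ (3 / 2 : ℝ)) * Real.log t ^ (2 / 3 : ℝ) :=
  zeta_bound747_of_exp_sum_bound12 fun N R t u hN hNt hu0 hu1 hNR hR ↦
    (hT2 N R t u hN hNt hu0 hu1 hNR hR).trans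
      (mul_le_mul_of_nonneg_right (by norm_num) (by positivity))

open FordVK in
/-- **Ford's Theorem 1 with `74.7` from the exponential-sum bound with constant `12` for `λ ≥ 8`
only** (`t ≥ N⁸`); the range `N ≤ t ≤ N⁸` is the theorem `FordVK.expSum_bound_small_lambda`.
[cite: Ford2002, Theorems 1–2] -/
theorem zeta_bound747_of_exp_sum_bound12_large_lambda
    (hT2 : ∀ (N R : ℕ) (t u : ℝ), 1 ≤ N → (N : ℝ) ^ 8 ≤ t → 0 < u → u ≤ 1 → N < R → R ≤ 2 * N →
      ‖∑ n ∈ Finset.Ioc N R, ((n : ℂ) + u) ^ (-(t * Complex.I))‖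
        ≤ 12 * (N : ℝ) ^ (1 - Real.log N ^ 2 / (133.66 * Real.log t ^ 2))) :
    ∀ σ t : ℝ, 3 ≤ t → 1 / 2 ≤ σ → σ ≤ 1 →
      ‖riemannZeta (σ + t * I)‖ ≤ 74.7 * t ^ (4.45 * (1 - σ) ^ (3 / 2 : ℝ)) * Real.log t ^ (2 / 3 : ℝ) :=
  zeta_bound747_of_exp_sum_bound12 fun N R t u hN hNt hu0 hu1 hNR hR => by
    rcases le_or_gt t ((N : ℝ) ^ 8) with h8 | h8
    · refine (expSum_bound_small_lambda N R t u hN hNt h8 hu0 hu1 hNR hR).trans ?_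
      exact mul_le_mul_of_nonneg_right (by norm_num) (by positivity)
    · exact hT2 N R t u hN h8.le hu0 hu1 hNR hR

/-- **`RichertBound 74.7 4.45` from the exponential-sum bound with constant `12`** (two-sided in
`t` by `RichertBound.of_pos`). [cite: Ford2002, Theorems 1–2] -/
theorem richertBound747_of_exp_sum_bound12
    (hT2 : ∀ (N R : ℕ) (t u : ℝ), 1 ≤ N → (N : ℝ) ≤ t → 0 < u → u ≤ 1 → N < R → R ≤ 2 * N →
      ‖∑ n ∈ Finset.Ioc N R, ((n : ℂ) + u) ^ (-(t * I))‖
        ≤ 12 * (N : ℝ) ^ (1 - Real.log N ^ 2 / (133.66 * Real.log t ^ 2))) :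
    RichertBound 74.7 4.45 :=
  RichertBound.of_pos (zeta_bound747_of_exp_sum_bound12 hT2)

/-- **`RichertBound 74.7 4.45` from Ford's Theorem 2 as printed.** [cite: Ford2002, Theorems 1–2] -/
theorem richertBound747_of_exp_sum_bound
    (hT2 : ∀ (N R : ℕ) (t u : ℝ), 1 ≤ N → (N : ℝ) ≤ t → 0 < u → u ≤ 1 → N < R → R ≤ 2 * N →
      ‖∑ n ∈ Finset.Ioc N R, ((n : ℂ) + u) ^ (-(t * I))‖
        ≤ 9.463 * (N : ℝ) ^ (1 - Real.log N ^ 2 / (133.66 * Real.log t ^ 2))) :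
    RichertBound 74.7 4.45 :=
  RichertBound.of_pos (zeta_bound747_of_exp_sum_bound hT2)

/-- **`RichertBound 74.7 4.45` from the exponential-sum bound with constant `12` for `λ ≥ 8`.**
[cite: Ford2002, Theorems 1–2] -/
theorem richertBound747_of_exp_sum_bound12_large_lambda
    (hT2 : ∀ (N R : ℕ) (t u : ℝ), 1 ≤ N → (N : ℝ) ^ 8 ≤ t → 0 < u → u ≤ 1 → N < R → R ≤ 2 * N →
      ‖∑ n ∈ Finset.Ioc N R, ((n : ℂ) + u) ^ (-(t * Complex.I))‖
        ≤ 12 * (N : ℝ) ^ (1 - Real.log N ^ 2 / (133.66 * Real.log t ^ 2))) :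
    RichertBound 74.7 4.45 :=
  RichertBound.of_pos (zeta_bound747_of_exp_sum_bound12_large_lambda hT2)

end Literature.NumberTheory.LFunctions
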